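import Summits.CriticalPhenomena.Ising3DConformalLimit.Theses.ReflectionTwin
import Summits.CriticalPhenomena.Ising3DConformalLimit.Theses.LogPolarProxy
import Summits.CriticalPhenomena.Ising3DConformalLimit.Theses.MirrorHoelderCompactness
import Summits.CriticalPhenomena.Ising3DConformalLimit.Theses.ClusterRigidity
import Summits.CriticalPhenomena.Ising3DConformalLimit.Theorems.LogPolarProxyExistsContinuousLimitLimitContinuity
import Summits.CriticalPhenomena.Ising3DConformalLimit.Theorems.HyperoctahedralRPExistsScaleCovariantLimitFoldedCurrentUniqueness
import HarnessLib

/-!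
# Strategist b1 sketch — crux `ReflectionTwin.ExistsContinuousLimit` (stmt-CriticalPhenomena-4582)

Scratch file of planner-cstrat-stmt-CriticalPhenomena-4582-b1-0 (2026-08-17). Three things:

1. the DECOMPOSITION certificate for route ReflectionTwin's copy of the crux, composed from landed theorems only
   (`LogPolarProxyExistsContinuousLimit.reflectionTwin_existsContinuousLimit_iff_existsScaleCovariantLimit`, p146967;
   `FoldedCurrentRepulsion.crux_iff_doubling_and_totallyDisconnected`, p139907): crux ⟺ item 6150 ∧ item 4659, and the
   glue `ExistsContinuousLimit_of_subs : TwoPointDoubling → ClusterSetTotallyDisconnected → ReflectionTwin.ExistsContinuousLimit`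
   (kernel-checked here; the Theorems-side landing is the lead c1's file `LogPolarProxyExistsContinuousLimitDoublingSplit.lean`);
2. the typed STRENGTHENINGS S⁺ of the census (`ExistsLimitWithMeshRate`, `FreeBoxUniformDoubling`) with the trivial
   directions that show what they cost;
3. nothing is proposed from this file (planner seat).
-/

noncomputable section

namespace Summit.CriticalPhenomena.Ising3DConformalLimit.Cruxes.ExistsContinuousLimit.StrategistB1

open Literature.Probability.LatticeModels
open Summit.CriticalPhenomena.Ising3DConformalLimit.Theses

/-! ## 1. Decomposition certificate (route ReflectionTwin's copy) -/

/-- The two route copies of the shared crux agree on the nose. -/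
theorem rt_iff_lpp : ReflectionTwin.ExistsContinuousLimit ↔ LogPolarProxy.ExistsContinuousLimit := Iff.rfl

/-- **crux (ReflectionTwin copy) ⟺ item 6150 ∧ item 4659** — composition of two landed `↔`. -/
theorem rt_crux_iff_doubling_and_totallyDisconnected :
    ReflectionTwin.ExistsContinuousLimit ↔
      MirrorHoelderCompactness.TwoPointDoubling ∧ ClusterRigidity.ClusterSetTotallyDisconnected :=
  LogPolarProxyExistsContinuousLimit.reflectionTwin_existsContinuousLimit_iff_existsScaleCovariantLimit.trans
    Cruxes.ExistsScaleCovariantLimit.FoldedCurrentRepulsion.crux_iff_doubling_and_totallyDisconnected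

/-- **THE GLUE OF THE SPLIT** for route ReflectionTwin: item 6150 → item 4659 → crux #4, by name. -/
theorem ExistsContinuousLimit_of_subs :
    MirrorHoelderCompactness.TwoPointDoubling → ClusterRigidity.ClusterSetTotallyDisconnected →
      ReflectionTwin.ExistsContinuousLimit :=
  fun hD hT => rt_crux_iff_doubling_and_totallyDisconnected.2 ⟨hD, hT⟩

/-- Neither child is decoration: the crux returns both (so the split is exact, not a weakening). -/
theorem subs_of_ExistsContinuousLimit (h : ReflectionTwin.ExistsContinuousLimit) :
    MirrorHoelderCompactness.TwoPointDoubling ∧ ClusterRigidity.ClusterSetTotallyDisconnected :=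
  rt_crux_iff_doubling_and_totallyDisconnected.1 h

/-- The honest residual of route ReflectionTwin after the split: its deciding theorem `closes` reads the sub-problem off
the route's OWN cruxes (TwinThreshold, TwinTransparency, TwinRotationGlue), the two children 6150/4659 of the shared
existence crux, and the shared tail (InversionUpgradeNormalised, IsingEuclidUpgradeR4NonGaussian). -/
theorem summit_of_items (hT : ReflectionTwin.TwinThreshold) (hTT : ReflectionTwin.TwinTransparency)
    (hD : MirrorHoelderCompactness.TwoPointDoubling) (hTD : ClusterRigidity.ClusterSetTotallyDisconnected)
    (hG : ReflectionTwin.TwinRotationGlue) (hI : ReflectionTwin.InversionUpgradeNormalised)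
    (hN : ReflectionTwin.IsingEuclidUpgradeR4NonGaussian) : _root_.Ising3DConformalLimit :=
  ReflectionTwin.closes hT hTT (ExistsContinuousLimit_of_subs hD hTD) hG hI hN

/-! ## 2. Typed strengthenings S⁺ (census §Strengthen) -/

/-- **S⁺₁ `ExistsLimitWithMeshRate`** — the crux PLUS a polynomial rate of convergence in the mesh on compacta of the
non-coincident configurations.  Strictly stronger in form; the census explains why the added rigidity (summable dyadic
increments) costs the corrections-to-scaling exponent ω > 0 and gives no mechanism for child 6150 (dead class
`decimation-homotopy-rate`, `Theorems/…DecimationMeshRateGivesCrux.lean`). -/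
def ExistsLimitWithMeshRate : Prop :=
  ∃ (ρ : ℝ → ℝ) (Δ : ℝ) (S : CorrFamily 3) (a : ℝ), (∀ δ ∈ Set.Ioc (0:ℝ) 1, 0 < ρ δ) ∧ 0 < Δ ∧ 0 < a ∧
    HasPointwiseScalingLimit (criticalCorr 3) ρ S ∧ (∀ n z, z ∉ NonCoincident 3 n → S n z = 0) ∧
    (∀ n, ContinuousOn (S n) (NonCoincident 3 n)) ∧ IsNondegenerateTwoPoint S ∧ IsTranslationInvariant S ∧
    IsScaleCovariant Δ S ∧
    ∀ (n : ℕ) (K : Set (Fin n → EuclideanSpace ℝ (Fin 3))), K ⊆ NonCoincident 3 n → IsCompact K →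
      ∃ C : ℝ, ∀ δ ∈ Set.Ioc (0:ℝ) 1, ∀ x ∈ K, |rescaledCorrelator (criticalCorr 3) ρ n δ x - S n x| ≤ C * δ ^ a

/-- S⁺₁ forgets to the crux (so it is a strengthening, not a transfer). -/
theorem ExistsContinuousLimit_of_meshRate (h : ExistsLimitWithMeshRate) : ReflectionTwin.ExistsContinuousLimit := by
  obtain ⟨ρ, Δ, S, a, hρ, hΔ, _ha, hlim, hzero, hcont, hnd, htr, hsc, _rate⟩ := h
  exact ⟨ρ, Δ, S, hρ, hΔ, hlim, hzero, hcont, hnd, htr, hsc⟩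

/-- **S⁺₂ `FreeBoxUniformDoubling`** — all-scale axis doubling of the FREE-boundary finite-volume critical two-point
function, uniformly in boxes `Λ_L ⊇ Λ_{4n}`: the finite-volume strengthening of child 6150 (`L → ∞` returns 6150 by the
box limit `hasBoxLimit_isingCorr_plus_free` + uniqueness of the critical state).  The census explains why the finite-volume
toolbox it unlocks (thin Simon–Lieb, sharpness `φ_{β_c}(Λ_L) ≥ 1`) is one-scale and propagates DISORDER (upper bounds),
the wrong direction for a doubling LOWER bound. -/
def FreeBoxUniformDoubling : Prop :=
  ∃ κ : ℝ, 0 < κ ∧ ∀ L n : ℕ, 1 ≤ n → 4 * n ≤ L →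
    κ * isingTwoPoint (zdGraph 3) (box 3 L) (criticalBeta 3) 0 .free (0 : Site 3) (Pi.single 0 (n : ℤ)) ≤
      isingTwoPoint (zdGraph 3) (box 3 L) (criticalBeta 3) 0 .free (0 : Site 3) (Pi.single 0 (2 * (n : ℤ)))

end Summit.CriticalPhenomena.Ising3DConformalLimit.Cruxes.ExistsContinuousLimit.StrategistB1

end
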